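import Summits.Ventures.CertifiedManyBodySolver.Observables.MeanFieldClassExclusionPolarisedCapV2LaUnderdoped
import Literature.MathematicalPhysics.QuantumLattice.HubbardFermiSeaTangentRows
import Literature.MathematicalPhysics.QuantumLattice.HubbardFermiSeaTangentRowsCS3AtlasC
import Literature.MathematicalPhysics.QuantumLattice.HubbardFermiSeaTangentRowsLowB
import Literature.MathematicalPhysics.QuantumLattice.HubbardFermiSeaTangentRowsLscoColumns
import Summits.Ventures.CertifiedManyBodySolver.Certificates.HubbardSquare_afhfCap_n1_U6
import HarnessLib

/-!
# Ventures/CertifiedManyBodySolver — Observables/MeanFieldClassExclusionStripAFCap.lean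

HONEST FRAMING: first certified bounds; not a superconductivity verdict; every number certified or labelled float.
A competing-order EXCLUSION removes a named class of candidate ground states; it never says which order is present;
no phase sentence follows.

Cell `hubbard-tc` (MO-S3, D-0096), seat `hubbard-tc-mod-3` (G3), `prover-hubbard-tc-mod-3-g6-0`. The HYPOTHESIS-FREE edition of the cell's FIRST G3
word, the memo-strip MF/BCS-class exclusion `m3Strip_docc_lt_sq_half_density_of` (`MeanFieldClassExclusionStrip.lean`, p467392: `t' ∈ [−3/10, 0]`,
`n = 7/8`, every `U ≥ 6`, CONDITIONAL on the certified GS ceilings #354 ∧ #445 at the anchors (8, 7/8, 0) / (8, 7/8, −1/4)). Here: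

* `stripP_n78_docc_lt` — `t' ∈ [−3/10, 0]`, `n = 7/8`, EVERY `U ≥ 29/5`: every GS torus limit has `Re ω(n_{0↑}n_{0↓}) < (7/16)²`, with NO claim node.

CAP at `U_c = 6` = the vacuum chord `(7/8)·C₆` of hubbard-box-p2's KERNEL-CHECKED antiferromagnetic Hartree–Fock half-filling cap plane
(`afhfCap_n1_U6_at`: `e₀(1, t', U, 1) ≤ −0.5920693929` for every `t'`, `U ≤ 6`; device `objE_vacChord_cap`); FLOOR = kernel Fermi-sea tangent rows at
`n₀ = 7/8` on the columns `−3/10 | −1/4 | −1/5 | −3/20 | 0` read between columns by the `t'`-chord (`objE_floorChord_mul`); TAIL =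
`doccN_lt_of_capUc_threshold` with `U_c = 6` (cap monotone in `U` below, Hartree–Fock slope `(n/2)²` above). Exact piece margins at `U₁ = 29/5`
(designer `hubbard-tc-mod-3/g6-replay/editions/`): `+0.0649`, `+0.0614`, `+0.0546`, `+0.0179` (binding at `t' = 0`). The conditional word stays true and cited.
WHAT THIS IS NOT: a statement about stripes, d-wave order or T_c; tight; a phase word.

References: Bach–Lieb–Solovej, J. Stat. Phys. 76 (1994) 3, eq. (2c.36) [BachLiebSolovej1994]; Koma–Tasaki, J. Stat. Phys. 76 (1994) 745, §1 [KomaTasaki1994];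
Lieb–Loss, Duke Math. J. 71 (1993) 337, §8 Thm 8.2 [LiebLoss1993]; Israel (1979) Thm I.3.4 [Israel1979]; Ruelle (1969) §3.3 [Ruelle1969].
-/

noncomputable section

namespace Summit.Ventures.CertifiedManyBodySolver.Observables

open Literature.MathematicalPhysics.QuantumLattice
open Literature.MathematicalPhysics.QuantumLattice.ThermodynamicLimit
open Summit.Ventures.CertifiedManyBodySolver.Certificates
open Matrix HubbardWave0 Literature.Probability.LatticeModels Filter Topology Set
open scoped ComplexOrder BigOperators

/-- **Memo strip `t' ∈ [−3/10, 0]`, `n = 7/8` — MF/BCS class excluded at EVERY `U ≥ 29/5`, HYPOTHESIS-FREE** (the conditional strip word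
`m3Strip_docc_lt_sq_half_density_of` needs #354 ∧ #445 and starts at `U = 6`). Every torus limit `ω` of unit `(rectN (7/8) L, S^z = 0)`-sector ground
states of `hubbardTorusTT' L 1 t' U` has `Re ω(n_{0↑}n_{0↓}) < (7/16)²`. Cap = vacuum chord of the kernel AF-HF half-filling cap at `U_c = 6`; floor =
`t'`-chords of the tangent rows at `n₀ = 7/8` on `−3/10 | −1/4 | −1/5 | −3/20 | 0`; margins `+0.0649 / +0.0614 / +0.0546 / +0.0179`.
[cite: BachLiebSolovej1994, eq. (2c.36)] [cite: KomaTasaki1994, §1] [cite: LiebLoss1993, §8, Theorem 8.2] -/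
theorem stripP_n78_docc_lt {t' U : ℝ} (ht1 : -3 / 10 ≤ t') (ht2 : t' ≤ 0) (hU : 29 / 5 ≤ U) :
    ∀ (ω : InfVolFermionState 2) (Ls : ℕ → ℕ) (ψ : ∀ L, Fock (Orb (FermionTorus 2 L))),
      Tendsto Ls atTop atTop →
      (∀ j, IsGroundStateInSector (hubbardTorusTT' (Ls j) 1 t' U) (rectN (7 / 8) (Ls j)) 0 (ψ (Ls j))) →
      (∀ j, star (ψ (Ls j)) ⬝ᵥ ψ (Ls j) = 1) → ω.IsTorusLimitOf ψ Ls →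
      (ω.expect ({0} : Finset (Site 2))
        (nAt 0 (Finset.mem_singleton_self 0) 0 * nAt 0 (Finset.mem_singleton_self 0) 1)).re < ((7 / 8 : ℝ) / 2) ^ 2 := by
  have hn0 : (0 : ℝ) ≤ 7 / 8 := by norm_num
  have hn2' : (7 / 8 : ℝ) < 2 := by norm_num
  have hcap := objE_vacChord_cap (n := 7 / 8) (by norm_num : (0 : ℝ) ≤ 6) (afhfCap_n1_U6_at t' (by norm_num : (0 : ℝ) ≤ 6) le_rfl)
    (by norm_num) (by norm_num)
  have r0 := fermiSeaTangentRow_tPrime_neg_three_div_ten_at_seven_div_eight (U := 0) le_rfl hn0 hn2'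
  have r1 := fermiSeaTangentRow_tPrime_neg_one_div_four_at_seven_div_eight (U := 0) le_rfl hn0 hn2'
  have r2 := fermiSeaTangentRow_tPrime_neg_one_div_five_at_seven_div_eight (U := 0) le_rfl hn0 hn2'
  have r3 := fermiSeaTangentRow_tPrime_neg_three_div_twenty_at_seven_div_eight (U := 0) le_rfl hn0 hn2'
  have r4 := fermiSeaTangentRow_tPrime_zero_at_seven_div_eight (U := 0) le_rfl hn0 hn2'
  rcases le_or_gt t' (-1 / 4) with hp0 | hp0
  · have hfl := objE_floorChord_mul (s := t') (n := 7 / 8) (k := 20) hn0 hn2' (by norm_num : (-3 / 10 : ℝ) < -1 / 4) r0 r1 ht1 hp0 (by norm_num)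
    exact doccN_lt_of_capUc_threshold (U₁ := 29 / 5) (Uc := 6) (n := 7 / 8) (by norm_num) (by norm_num) hU hn0 hn2' hcap hfl (by linarith)
  · -- `t' > -1/4`
    rcases le_or_gt t' (-1 / 5) with hp1 | hp1
    · have hfl := objE_floorChord_mul (s := t') (n := 7 / 8) (k := 20) hn0 hn2' (by norm_num : (-1 / 4 : ℝ) < -1 / 5) r1 r2 hp0.le hp1 (by norm_num)
      exact doccN_lt_of_capUc_threshold (U₁ := 29 / 5) (Uc := 6) (n := 7 / 8) (by norm_num) (by norm_num) hU hn0 hn2' hcap hfl (by linarith)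
    · -- `t' > -1/5`
      rcases le_or_gt t' (-3 / 20) with hp2 | hp2
      · have hfl := objE_floorChord_mul (s := t') (n := 7 / 8) (k := 20) hn0 hn2' (by norm_num : (-1 / 5 : ℝ) < -3 / 20) r2 r3 hp1.le hp2 (by norm_num)
        exact doccN_lt_of_capUc_threshold (U₁ := 29 / 5) (Uc := 6) (n := 7 / 8) (by norm_num) (by norm_num) hU hn0 hn2' hcap hfl (by linarith)
      · -- `t' > -3/20`
        have hfl := objE_floorChord_mul (s := t') (n := 7 / 8) (k := 20 / 3) hn0 hn2' (by norm_num : (-3 / 20 : ℝ) < 0) r3 r4 hp2.le ht2 (by norm_num)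
        exact doccN_lt_of_capUc_threshold (U₁ := 29 / 5) (Uc := 6) (n := 7 / 8) (by norm_num) (by norm_num) hU hn0 hn2' hcap hfl (by linarith)

end Summit.Ventures.CertifiedManyBodySolver.Observables

end
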